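import Summits.Parity.BatemanHorn.Theorems.SelbergDelangeRigidityLSDRealSegmentTypeISandwich
import HarnessLib

/-!
# Route `SelbergDelangeRigidity`, crux `LSDRealSegment` (stmt-Parity-9770), line
# `product-anatomy-subcritical`: the SUB-LEVEL cheap rows (helper of `stub_cheapRows`)

Complete-period counting for the rows `R_x(e; σ, α, β) = cheapRow f σ α β e x` of the vocabulary file
`SelbergDelangeRigidityDefs`: for every tuple `p` of box primes the mixed condition
`C_p(n) : e ∣ ∏ᵢ fᵢ(n) ∧ ∀ j, pⱼ ∣ f_{σ j}(n)` is `Q`-periodic, `Q = e ∏ pⱼ`, so on `[1, x]` it holds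
`x · δ_p + θ Q δ_p` times, `|θ| ≤ 1`, `δ_p = mixedDens f e σ p` (`abs_rowCount_sub_le`, from the tree's
`abs_card_filter_Ico_sub_le`).  Summing over the tuples, `|R_x − x Σ δ_p| ≤ (max Q) Σ δ_p`, and
`Q ≤ e ∏ x^{βⱼ} ≤ x^{η' + Σ βⱼ}`: whenever `η' + Σⱼ βⱼ < 1` (modulus below the length — the SUB-LEVEL rows)
the relative error is `≤ x^{η' + Σβ − 1} → 0`, uniformly in the twist `e ≤ x^{η'}` and with no hypothesis on
`f` at all (`cheapRows_subLevel`, the registered helper).  Also: the `s = 0` row is the plain root count of the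
product to the modulus `e` (`cheapRow_fin_zero`, `cheapMain_fin_zero`).
-/

open Filter Finset Polynomial
open scoped BigOperators Topology Classical

namespace Summit.Parity.BatemanHorn.Cruxes.LSDRealSegment.ProductAnatomySubcritical

open Literature.NumberTheory.Sieve
open ArithmeticFunction (cardFactors)
noncomputable section

variable {k s : ℕ}

/-! ### Periodicity of the mixed condition -/

/-- `n ↦ [d ∣ g(n)]` is `d`-periodic (`(a − b) ∣ g(a) − g(b)`). [folklore] -/
theorem periodic_dvd_eval (g : ℤ[X]) (d : ℕ) :
    Function.Periodic (fun n : ℕ => (d : ℤ) ∣ g.eval (n : ℤ)) d := by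
  intro n
  simp only [eq_iff_iff]
  have h : ((n + d : ℕ) : ℤ) - (n : ℤ) ∣ g.eval ((n + d : ℕ) : ℤ) - g.eval (n : ℤ) :=
    Polynomial.sub_dvd_eval_sub _ _ _
  rw [show ((n + d : ℕ) : ℤ) - (n : ℤ) = d by push_cast; ring] at h
  exact dvd_iff_dvd_of_dvd_sub h

/-- The mixed condition `e ∣ ∏ᵢ fᵢ(n) ∧ ∀ j, pⱼ ∣ f_{σ j}(n)` is `e ∏ pⱼ`-periodic in `n`. [folklore] -/
theorem periodic_mixedCond (f : Fin k → ℤ[X]) (e : ℕ) (σ : Fin s → Fin k) (p : Fin s → ℕ) :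
    Function.Periodic (fun n : ℕ =>
      (e : ℤ) ∣ ∏ i, (f i).eval (n : ℤ) ∧ ∀ j, (p j : ℤ) ∣ (f (σ j)).eval (n : ℤ)) (e * ∏ j, p j) := by
  have hQ1 : Function.Periodic (fun n : ℕ => (e : ℤ) ∣ ∏ i, (f i).eval (n : ℤ)) (e * ∏ j, p j) := by
    have := (periodic_dvd_prod_eval f e).nat_mul (∏ j, p j)
    rwa [Nat.cast_id, mul_comm] at this
  have hQ2 : ∀ j, Function.Periodic (fun n : ℕ => (p j : ℤ) ∣ (f (σ j)).eval (n : ℤ)) (e * ∏ j, p j) := by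
    intro j
    have hsplit : e * ∏ j, p j = (e * ∏ i ∈ univ.erase j, p i) * p j := by
      rw [mul_assoc, Finset.prod_erase_mul _ _ (mem_univ j)]
    have := (periodic_dvd_eval (f (σ j)) (p j)).nat_mul (e * ∏ i ∈ univ.erase j, p i)
    rwa [Nat.cast_id, ← hsplit] at this
  intro n
  simp only [eq_iff_iff]
  exact and_congr (iff_of_eq (hQ1 n)) (forall_congr' fun j => iff_of_eq (hQ2 j n))

/-! ### One tuple: complete periods on `[1, x]` -/

/-- For ONE tuple `p` (all `pⱼ ≥ 1`) and a twist `e ≥ 1`: the mixed condition holds on `[1, x]`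
`x δ_p + θ Q δ_p` times with `|θ| ≤ 1`, `Q = e ∏ pⱼ`, `δ_p = mixedDens f e σ p` (so `Q δ_p = #` of good residues
per period). [folklore] -/
theorem abs_rowCount_sub_le (f : Fin k → ℤ[X]) {e : ℕ} (he : 1 ≤ e) (σ : Fin s → Fin k)
    {p : Fin s → ℕ} (hp : ∀ j, 1 ≤ p j) (x : ℕ) :
    |(#((Icc 1 x).filter fun n : ℕ =>
        (e : ℤ) ∣ ∏ i, (f i).eval (n : ℤ) ∧ ∀ j, (p j : ℤ) ∣ (f (σ j)).eval (n : ℤ)) : ℝ)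
      - (x : ℝ) * mixedDens f e σ p| ≤ ((e * ∏ j, p j : ℕ) : ℝ) * mixedDens f e σ p := by
  have hQ : 0 < e * ∏ j, p j := Nat.mul_pos he (Finset.prod_pos fun j _ => hp j)
  have hQ' : (0 : ℝ) < ((e * ∏ j, p j : ℕ) : ℝ) := by exact_mod_cast hQ
  have hper := abs_card_filter_Ico_sub_le _ hQ (periodic_mixedCond f e σ p) 1 x
  rw [add_comm, Finset.Ico_add_one_right_eq_Icc] at hper
  unfold mixedDens
  have key : ∀ A ρ : ℝ, |A - (x : ℝ) * ρ / ((e * ∏ j, p j : ℕ) : ℝ)| ≤ ρ →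
      |A - (x : ℝ) * (ρ / ((e * ∏ j, p j : ℕ) : ℝ))| ≤
        ((e * ∏ j, p j : ℕ) : ℝ) * (ρ / ((e * ∏ j, p j : ℕ) : ℝ)) := by
    intro A ρ h
    rwa [mul_div_assoc', mul_div_assoc', mul_div_cancel_left₀ _ hQ'.ne']
  exact key _ _ hper

/-- A box prime is `≥ 1` and `≤ x^{βⱼ}`. [folklore] -/
theorem one_le_and_le_rpow_of_mem_boxTuples {α β : Fin s → ℝ} {x : ℕ} {p : Fin s → ℕ}
    (hp : p ∈ boxTuples s α β x) (j : Fin s) : 1 ≤ p j ∧ (p j : ℝ) ≤ (x : ℝ) ^ β j := by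
  unfold boxTuples at hp
  rw [Finset.mem_filter, Fintype.mem_piFinset] at hp
  have hj := hp.1 j
  rw [Finset.mem_filter, Finset.mem_Icc] at hj
  refine ⟨hj.1.1, ?_⟩
  calc (p j : ℝ) ≤ (⌊(x : ℝ) ^ β j⌋₊ : ℝ) := by exact_mod_cast hj.1.2
    _ ≤ (x : ℝ) ^ β j := Nat.floor_le (Real.rpow_nonneg (Nat.cast_nonneg x) _)

/-- `mixedDens ≥ 0`. [folklore] -/
theorem mixedDens_nonneg (f : Fin k → ℤ[X]) (e : ℕ) (σ : Fin s → Fin k) (p : Fin s → ℕ) :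
    0 ≤ mixedDens f e σ p := by
  unfold mixedDens
  positivity

/-- `cheapMain ≥ 0`. [folklore] -/
theorem cheapMain_nonneg (f : Fin k → ℤ[X]) (σ : Fin s → Fin k) (α β : Fin s → ℝ) (e x : ℕ) :
    0 ≤ cheapMain f σ α β e x := by
  unfold cheapMain
  exact mul_nonneg (Nat.cast_nonneg x) (Finset.sum_nonneg fun p _ => mixedDens_nonneg f e σ p)

/-! ### All tuples: the row against its main term -/

/-- Summing the complete-period bound over the box tuples:
`|R_x(e) − x Σ_p δ_p| ≤ Σ_p Q_p δ_p` (`Q_p = e ∏ pⱼ`). [folklore] -/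
theorem abs_cheapRow_sub_cheapMain_le_sum (f : Fin k → ℤ[X]) (σ : Fin s → Fin k) (α β : Fin s → ℝ)
    {e : ℕ} (he : 1 ≤ e) (x : ℕ) :
    |(cheapRow f σ α β e x : ℝ) - cheapMain f σ α β e x| ≤
      ∑ p ∈ boxTuples s α β x, ((e * ∏ j, p j : ℕ) : ℝ) * mixedDens f e σ p := by
  unfold cheapRow cheapMain
  rw [Nat.cast_sum, Finset.mul_sum, ← Finset.sum_sub_distrib]
  refine (Finset.abs_sum_le_sum_abs _ _).trans (Finset.sum_le_sum fun p hp => ?_)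
  exact abs_rowCount_sub_le f he σ (fun j => (one_le_and_le_rpow_of_mem_boxTuples hp j).1) x

/-- … and bounding every modulus by `e · x^{Σ βⱼ}`:
`|R_x(e) − cheapMain| ≤ e x^{Σβ} Σ_p δ_p = (e x^{Σβ} / x) · cheapMain` for `x ≥ 1`. [folklore] -/
theorem abs_cheapRow_sub_cheapMain_le (f : Fin k → ℤ[X]) (σ : Fin s → Fin k) (α β : Fin s → ℝ)
    {e : ℕ} (he : 1 ≤ e) {x : ℕ} (hx : 1 ≤ x) :
    |(cheapRow f σ α β e x : ℝ) - cheapMain f σ α β e x| ≤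
      (e : ℝ) * (x : ℝ) ^ (∑ j, β j) / x * cheapMain f σ α β e x := by
  have hx0 : (0 : ℝ) < x := by exact_mod_cast hx
  refine (abs_cheapRow_sub_cheapMain_le_sum f σ α β he x).trans ?_
  have hQ : ∀ p ∈ boxTuples s α β x, ((e * ∏ j, p j : ℕ) : ℝ) ≤ (e : ℝ) * (x : ℝ) ^ (∑ j, β j) := by
    intro p hp
    push_cast
    refine mul_le_mul_of_nonneg_left ?_ (Nat.cast_nonneg e)
    rw [Real.rpow_sum_of_pos hx0]
    exact Finset.prod_le_prod (fun j _ => Nat.cast_nonneg _)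
      fun j _ => (one_le_and_le_rpow_of_mem_boxTuples hp j).2
  calc ∑ p ∈ boxTuples s α β x, ((e * ∏ j, p j : ℕ) : ℝ) * mixedDens f e σ p
      ≤ ∑ p ∈ boxTuples s α β x, ((e : ℝ) * (x : ℝ) ^ (∑ j, β j)) * mixedDens f e σ p :=
        Finset.sum_le_sum fun p hp => mul_le_mul_of_nonneg_right (hQ p hp) (mixedDens_nonneg f e σ p)
    _ = (e : ℝ) * (x : ℝ) ^ (∑ j, β j) / x * cheapMain f σ α β e x := by
        unfold cheapMain
        rw [← Finset.mul_sum]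
        field_simp

/-! ### The registered helper: sub-level rows are asymptotic, uniformly in the twist -/

/-- **cheapRows_subLevel** (registered helper of `stub_cheapRows`, line `product-anatomy-subcritical`):
for ANY family `f`, assignment `σ`, boxes `(x^{αⱼ}, x^{βⱼ}]` and twist level `η'` with `η' + Σⱼ βⱼ < 1`
(modulus `e ∏ pⱼ ≤ x^{η' + Σβ} = o(x)`: the SUB-LEVEL rows), and every `ε > 0`: eventually in `x`, uniformly over
all twists `1 ≤ e ≤ x^{η'}`, `|R_x(e; σ, α, β) − cheapMain| ≤ ε · cheapMain` (complete periods; relative error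
`≤ x^{η' + Σβ − 1}`). [folklore] -/
theorem cheapRows_subLevel : ∀ (k : ℕ) (f : Fin k → ℤ[X]) (s : ℕ) (σ : Fin s → Fin k) (α β : Fin s → ℝ)
    (η' : ℝ), η' + (∑ j, β j) < 1 → ∀ ε : ℝ, 0 < ε → ∀ᶠ x : ℕ in atTop, ∀ e : ℕ, 1 ≤ e →
      (e : ℝ) ≤ (x : ℝ) ^ η' →
        |(cheapRow f σ α β e x : ℝ) - cheapMain f σ α β e x| ≤ ε * cheapMain f σ α β e x := by
  intro k f s σ α β η' hsub ε hε
  set γ : ℝ := 1 - (η' + ∑ j, β j) with hγ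
  have hγ0 : 0 < γ := by rw [hγ]; linarith
  have hsmall : ∀ᶠ x : ℕ in atTop, ((x : ℝ) ^ (-γ)) < ε :=
    (tendsto_order.1 ((tendsto_rpow_neg_atTop hγ0).comp tendsto_natCast_atTop_atTop)).2 ε hε
  filter_upwards [hsmall, Filter.eventually_ge_atTop 1] with x hxε hx e he hex
  have hx0 : (0 : ℝ) < x := by exact_mod_cast hx
  have hmain0 := cheapMain_nonneg f σ α β e x
  refine (abs_cheapRow_sub_cheapMain_le f σ α β he hx).trans (mul_le_mul_of_nonneg_right ?_ hmain0)
  have hexp : (e : ℝ) * (x : ℝ) ^ (∑ j, β j) / x ≤ (x : ℝ) ^ (-γ) := by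
    rw [div_le_iff₀ hx0]
    have h1 : (x : ℝ) ^ (-γ) * x = (x : ℝ) ^ η' * (x : ℝ) ^ (∑ j, β j) := by
      rw [← Real.rpow_add hx0, ← Real.rpow_add_one hx0.ne', hγ]
      ring_nf
    rw [h1]
    exact mul_le_mul_of_nonneg_right hex (Real.rpow_nonneg hx0.le _)
  exact hexp.trans hxε.le

/-! ### The `s = 0` row: a plain root count of the product to the modulus `e` -/

/-- With no boxes every (empty) tuple qualifies: `boxTuples 0 = univ` (a singleton). [folklore] -/
theorem boxTuples_fin_zero (α β : Fin 0 → ℝ) (x : ℕ) : boxTuples 0 α β x = univ := by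
  unfold boxTuples
  rw [Fintype.piFinset_of_isEmpty, Finset.filter_true_of_mem fun p _ => Function.injective_of_subsingleton p]

/-- The `s = 0` row is `#{1 ≤ n ≤ x : e ∣ ∏ᵢ fᵢ(n)}`. [folklore] -/
theorem cheapRow_fin_zero (f : Fin k → ℤ[X]) (σ : Fin 0 → Fin k) (α β : Fin 0 → ℝ) (e x : ℕ) :
    cheapRow f σ α β e x = #((Icc 1 x).filter fun n : ℕ => (e : ℤ) ∣ ∏ i, (f i).eval (n : ℤ)) := by
  unfold cheapRow
  rw [boxTuples_fin_zero, Fintype.sum_unique]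
  congr 1
  exact Finset.filter_congr fun n _ => by simp

/-- The `s = 0` main term is `x · ρ_F(e)/e`, `ρ_F = polyRootCountMod f`. [folklore] -/
theorem cheapMain_fin_zero (f : Fin k → ℤ[X]) (σ : Fin 0 → Fin k) (α β : Fin 0 → ℝ) (e x : ℕ) :
    cheapMain f σ α β e x = (x : ℝ) * ((polyRootCountMod f e : ℝ) / e) := by
  unfold cheapMain mixedDens polyRootCountMod
  rw [boxTuples_fin_zero, Fintype.sum_unique]
  simp

/-- **cheapRows_pureTwist** (the `s = 0` row of EVERY family, below level `1`): for `η' < 1` and `ε > 0`,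
eventually in `x`, uniformly over the twists `1 ≤ e ≤ x^{η'}`,
`|#{1 ≤ n ≤ x : e ∣ ∏ᵢ fᵢ(n)} − x ρ_F(e)/e| ≤ ε · x ρ_F(e)/e` (complete periods: the error is `≤ ρ_F(e)` while
the main term is `≥ x^{1−η'} ρ_F(e)`; at `η' = 1` this FAILS, see the `Negative` companion). [folklore] -/
theorem cheapRows_pureTwist : ∀ (k : ℕ) (f : Fin k → ℤ[X]) (η' : ℝ), η' < 1 → ∀ ε : ℝ, 0 < ε →
    ∀ᶠ x : ℕ in atTop, ∀ e : ℕ, 1 ≤ e → (e : ℝ) ≤ (x : ℝ) ^ η' →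
      |(#((Icc 1 x).filter fun n : ℕ => (e : ℤ) ∣ ∏ i, (f i).eval (n : ℤ)) : ℝ)
          - (x : ℝ) * ((polyRootCountMod f e : ℝ) / e)| ≤
        ε * ((x : ℝ) * ((polyRootCountMod f e : ℝ) / e)) := by
  intro k f η' hη' ε hε
  have h := cheapRows_subLevel k f 0 Fin.elim0 Fin.elim0 Fin.elim0 η' (by simpa using hη') ε hε
  filter_upwards [h] with x hx e he hex
  have := hx e he hex
  rwa [cheapRow_fin_zero, cheapMain_fin_zero] at this

end

end Summit.Parity.BatemanHorn.Cruxes.LSDRealSegment.ProductAnatomySubcritical
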